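import Mathlib

/-!
# night-2: the doubly degenerate regime for large `N` — three product families

Counting lemmas for the large-`N` argument of the doubly degenerate regime (`m = |W ∖ {x}| ≥ 10`): the families are
built from two disjoint cells `U, V ⊆ W` (and a third cell `L`), their sizes are products:
* **`card_filter_meets_two_ge`**: the pairs meeting both `U` and `V` number `≥ |U| · |V|`;
* **`card_filter_meets_three_ge`**: the triples meeting `U` and `V` number `≥ |U| · |V| · |L|` (`L` a third disjoint cell);
* **`card_filter_two_off_ge`**: the triples with two points of `U` and a point off a set `C ⊇ U` number
  `≥ C(|U|, 2) · |W ∖ C|`.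
Each is an injection `(a, q) ↦ {a, q}`, `(a, q, p) ↦ {a, q, p}`, `(P, v) ↦ insert v P` into the family.
-/

namespace PercRepro.Shadow

variable {α : Type*} [DecidableEq α]

/-- **Pairs meeting two disjoint cells**: `|U| · |V| ≤ #{Y ⊆ W, |Y| = 2, Y ∩ U ≠ ∅, Y ∩ V ≠ ∅}`. -/
theorem card_filter_meets_two_ge (W U V : Finset α) (hU : U ⊆ W) (hV : V ⊆ W) (hUV : Disjoint U V) :
    U.card * V.card ≤
      ((W.powersetCard 2).filter (fun Y => (Y ∩ U).Nonempty ∧ (Y ∩ V).Nonempty)).card := by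
  rw [← Finset.card_product]
  apply Finset.card_le_card_of_injOn (fun p : α × α => ({p.1, p.2} : Finset α))
  · intro p hp
    rw [Finset.mem_coe, Finset.mem_product] at hp
    have hne : p.1 ≠ p.2 := fun h => Finset.disjoint_left.1 hUV hp.1 (h ▸ hp.2)
    rw [Finset.mem_coe, Finset.mem_filter, Finset.mem_powersetCard]
    refine ⟨⟨?_, Finset.card_pair hne⟩, ⟨p.1, ?_⟩, ⟨p.2, ?_⟩⟩
    · intro e he
      rw [Finset.mem_insert, Finset.mem_singleton] at he
      rcases he with rfl | rfl
      · exact hU hp.1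
      · exact hV hp.2
    · exact Finset.mem_inter.2 ⟨Finset.mem_insert_self _ _, hp.1⟩
    · exact Finset.mem_inter.2 ⟨Finset.mem_insert_of_mem (Finset.mem_singleton_self _), hp.2⟩
  · intro p hp q hq hpq
    rw [Finset.mem_coe, Finset.mem_product] at hp hq
    simp only at hpq
    have h1 : p.1 ∈ ({q.1, q.2} : Finset α) := hpq ▸ Finset.mem_insert_self _ _
    have h2 : p.2 ∈ ({q.1, q.2} : Finset α) := hpq ▸ Finset.mem_insert_of_mem (Finset.mem_singleton_self _)
    rw [Finset.mem_insert, Finset.mem_singleton] at h1 h2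
    have e1 : p.1 = q.1 := by
      rcases h1 with h | h
      · exact h
      · exact absurd (h ▸ hp.1) (Finset.disjoint_right.1 hUV hq.2)
    have e2 : p.2 = q.2 := by
      rcases h2 with h | h
      · exact absurd (h ▸ hp.2) (Finset.disjoint_left.1 hUV hq.1)
      · exact h
    exact Prod.ext e1 e2

/-- **Triples meeting two disjoint cells, with a third cell**: `|U| · |V| · |L| ≤ #{Y ⊆ W, |Y| = 3, Y ∩ U ≠ ∅, Y ∩ V ≠ ∅}`
(`U, V, L ⊆ W` pairwise disjoint). -/
theorem card_filter_meets_three_ge (W U V L : Finset α) (hU : U ⊆ W) (hV : V ⊆ W) (hL : L ⊆ W)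
    (hUV : Disjoint U V) (hUL : Disjoint U L) (hVL : Disjoint V L) :
    U.card * V.card * L.card ≤
      ((W.powersetCard 3).filter (fun Y => (Y ∩ U).Nonempty ∧ (Y ∩ V).Nonempty)).card := by
  rw [← Finset.card_product, ← Finset.card_product]
  apply Finset.card_le_card_of_injOn (fun p : (α × α) × α => ({p.1.1, p.1.2, p.2} : Finset α))
  · intro p hp
    rw [Finset.mem_coe, Finset.mem_product, Finset.mem_product] at hp
    obtain ⟨⟨ha, hq⟩, hl⟩ := hp
    have h12 : p.1.1 ≠ p.1.2 := fun h => Finset.disjoint_left.1 hUV ha (h ▸ hq)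
    have h13 : p.1.1 ≠ p.2 := fun h => Finset.disjoint_left.1 hUL ha (h ▸ hl)
    have h23 : p.1.2 ≠ p.2 := fun h => Finset.disjoint_left.1 hVL hq (h ▸ hl)
    rw [Finset.mem_coe, Finset.mem_filter, Finset.mem_powersetCard]
    refine ⟨⟨?_, ?_⟩, ⟨p.1.1, ?_⟩, ⟨p.1.2, ?_⟩⟩
    · intro e he
      simp only [Finset.mem_insert, Finset.mem_singleton] at he
      rcases he with rfl | rfl | rfl
      · exact hU ha
      · exact hV hq
      · exact hL hl
    · rw [Finset.card_insert_of_notMem, Finset.card_pair h23]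
      simp only [Finset.mem_insert, Finset.mem_singleton, not_or]
      exact ⟨h12, h13⟩
    · exact Finset.mem_inter.2 ⟨Finset.mem_insert_self _ _, ha⟩
    · exact Finset.mem_inter.2 ⟨Finset.mem_insert_of_mem (Finset.mem_insert_self _ _), hq⟩
  · intro p hp q hq hpq
    rw [Finset.mem_coe, Finset.mem_product, Finset.mem_product] at hp hq
    obtain ⟨⟨ha, hq'⟩, hl⟩ := hp
    obtain ⟨⟨ha', hq''⟩, hl'⟩ := hq
    simp only at hpq
    have h1 : p.1.1 ∈ ({q.1.1, q.1.2, q.2} : Finset α) := hpq ▸ Finset.mem_insert_self _ _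
    have h2 : p.1.2 ∈ ({q.1.1, q.1.2, q.2} : Finset α) :=
      hpq ▸ Finset.mem_insert_of_mem (Finset.mem_insert_self _ _)
    have h3 : p.2 ∈ ({q.1.1, q.1.2, q.2} : Finset α) :=
      hpq ▸ Finset.mem_insert_of_mem (Finset.mem_insert_of_mem (Finset.mem_singleton_self _))
    simp only [Finset.mem_insert, Finset.mem_singleton] at h1 h2 h3
    have e1 : p.1.1 = q.1.1 := by
      rcases h1 with h | h | h
      · exact h
      · exact absurd (h ▸ ha) (Finset.disjoint_right.1 hUV hq'')
      · exact absurd (h ▸ ha) (Finset.disjoint_right.1 hUL hl')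
    have e2 : p.1.2 = q.1.2 := by
      rcases h2 with h | h | h
      · exact absurd (h ▸ hq') (Finset.disjoint_left.1 hUV ha')
      · exact h
      · exact absurd (h ▸ hq') (Finset.disjoint_right.1 hVL hl')
    have e3 : p.2 = q.2 := by
      rcases h3 with h | h | h
      · exact absurd (h ▸ hl) (Finset.disjoint_left.1 hUL ha')
      · exact absurd (h ▸ hl) (Finset.disjoint_left.1 hVL hq'')
      · exact h
    exact Prod.ext (Prod.ext e1 e2) e3

/-- **Two points of a cell and a point off its line**: `C(|U|, 2) · |W ∖ C| ≤ #{Y ⊆ W, |Y| = 3, |Y ∩ U| ≥ 2, Y ⊄ C}`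
for `U ⊆ C`. -/
theorem card_filter_two_off_ge (W U C : Finset α) (hU : U ⊆ W) (hUC : U ⊆ C) :
    U.card.choose 2 * (W.filter (fun e => e ∉ C)).card ≤
      ((W.powersetCard 3).filter (fun Y => 2 ≤ (Y ∩ U).card ∧ ¬ Y ⊆ C)).card := by
  rw [← Finset.card_powersetCard, ← Finset.card_product]
  apply Finset.card_le_card_of_injOn (fun p : Finset α × α => insert p.2 p.1)
  · intro p hp
    rw [Finset.mem_coe, Finset.mem_product, Finset.mem_powersetCard, Finset.mem_filter] at hp
    obtain ⟨⟨hPU, hP2⟩, hvW, hvC⟩ := hp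
    have hvP : p.2 ∉ p.1 := fun h => hvC (hUC (hPU h))
    rw [Finset.mem_coe, Finset.mem_filter, Finset.mem_powersetCard]
    refine ⟨⟨Finset.insert_subset hvW (hPU.trans hU), by rw [Finset.card_insert_of_notMem hvP, hP2]⟩, ?_, ?_⟩
    · calc 2 = p.1.card := hP2.symm
        _ ≤ (insert p.2 p.1 ∩ U).card := by
          apply Finset.card_le_card
          intro e he
          exact Finset.mem_inter.2 ⟨Finset.mem_insert_of_mem he, hPU he⟩
    · intro h
      exact hvC (h (Finset.mem_insert_self _ _))
  · intro p hp q hq hpq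
    rw [Finset.mem_coe, Finset.mem_product, Finset.mem_powersetCard, Finset.mem_filter] at hp hq
    obtain ⟨⟨hPU, hP2⟩, hvW, hvC⟩ := hp
    obtain ⟨⟨hQU, hQ2⟩, hwW, hwC⟩ := hq
    simp only at hpq
    -- `p.2` is the unique point of the set off `C`
    have hv : p.2 ∈ insert q.2 q.1 := hpq ▸ Finset.mem_insert_self _ _
    rw [Finset.mem_insert] at hv
    have e2 : p.2 = q.2 := by
      rcases hv with h | h
      · exact h
      · exact absurd (hUC (hQU h)) hvC
    -- the rest is the set inside `U`
    have e1 : p.1 = q.1 := by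
      ext e
      constructor
      · intro he
        have : e ∈ insert q.2 q.1 := hpq ▸ Finset.mem_insert_of_mem he
        rw [Finset.mem_insert] at this
        rcases this with h | h
        · exact absurd (h ▸ hUC (hPU he)) hwC
        · exact h
      · intro he
        have : e ∈ insert p.2 p.1 := hpq.symm ▸ Finset.mem_insert_of_mem he
        rw [Finset.mem_insert] at this
        rcases this with h | h
        · exact absurd (h ▸ hUC (hQU he)) hvC
        · exact h
    exact Prod.ext e1 e2

end PercRepro.Shadow
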